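import Mathlib
import HarnessLib
import Literature.AlgebraicGeometry.Resolution.Lipman1969RationalSurfaceSingularities
import Literature.AlgebraicGeometry.Resolution.ExceptionalCurvePoints
import Literature.AlgebraicGeometry.Resolution.ExceptionalFibreConnected
import Literature.AlgebraicGeometry.Resolution.ExceptionalPointsFinite
import Literature.AlgebraicGeometry.Resolution.ProperBirationalGlobalSections
import Literature.AlgebraicGeometry.Morphisms.CechH2FibreDimOne
import Literature.AlgebraicGeometry.Resolution.AffineDomainDimension
import Literature.RingTheory.CohomologyAnnihilator.Completion
import Summits.ResolutionOfSingularities.ResolutionOfSingularities.Theorems.HomologicalConductorNoZenoCaCarriedTower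
import Summits.ResolutionOfSingularities.ResolutionOfSingularities.Theorems.HomologicalConductorNoZenoCarriedPrincipalClosed
import Summits.ResolutionOfSingularities.ResolutionOfSingularities.Theorems.HomologicalConductorNoZenoLemmaLDischarged
import Summits.ResolutionOfSingularities.ResolutionOfSingularities.Theorems.HomologicalConductorNoZenoG2Assembly
import Summits.ResolutionOfSingularities.ResolutionOfSingularities.Theorems.HomologicalConductorNoZenoFullSheafLocallyFreeGW
import Summits.ResolutionOfSingularities.ResolutionOfSingularities.Theorems.HomologicalConductorNoZenoFullSheafDualCech

/-!
# Crux chain W4.4 (`HomologicalConductor.NoZenoR`, stmt-ResolutionOfSingularities-19943), SUPPORT level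
# (kill test `SurfaceTermination`, stmt-ResolutionOfSingularities-16488):
# **(A-rat) THEOREM A for an arbitrary rational surface singularity** — `ca(T)·𝒪_{X_min}` is invertible

Route `ResolutionOfSingularities/HomologicalConductor`.  OURS (cell res-hironaka, crux chain W4.4: CHAIN v11/v11.1
§2 α-reserve row «(A-rat)», res-plan-2 IDLE POOL DEAL 2026-08-27T08:39:07Z (c), director-resolution IDLE-HEADROOM
ORDER 08:35:13Z; seat res-D-pv-045 = res-L0-w44-stub-8); SUPPORT-level work for the kill test `SurfaceTermination`
(stmt-ResolutionOfSingularities-16488) — it does not move the crux (CHAIN note 48); nothing here is a statement of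
the manuscript under review (Hironaka 2017); AI-written, weaker than expert review.

THEOREM A of the chain (res-L0-w44-lead-1, `stub_caInvertibleMinRes`, p513073) is stated for a singular
sandwiched STAGE `T_m` of the canonical `ca`-tower, where rationality (`H¹(X, 𝒪_X) = 0`) is DERIVED from
Lipman (1.2) and `ca(T_m) ⊇ 𝔪^c` from the essentially-finite-type nature of the stage.  This file opens the
three tower wrappers and proves the same conclusion for ANY two-dimensional Noetherian local normal domain `T`
and ANY resolution `π : X ⟶ Spec T` (minimality is never used by the proof), taking as HYPOTHESES
* `hrat : HasTrivialCechH1 π` — the singularity is rational;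
* `hca : ∃ c, 𝔪^c ≤ ca(T)` — the cohomology annihilator is `𝔪`-primary (for a complete / essentially
  finite-type isolated singularity this is Iyengar–Takahashi; without an excellence / J-2 hypothesis the tree
  has no theorem making `ca` of a two-dimensional normal local domain `𝔪`-primary, so the hypothesis is kept);
and CONDITIONAL on exactly two printed facts: Lipman 1969 (12.1) (ii) and Görtz–Wedhorn II Cor. 24.44
(`H² = 0` above fibre dimension one).  Lipman (1.2), Cossart–Jannsen–Saito and Lipman (4.1)/(12.1)(i) of the
registered six-conjunction are not used.

Contents:
* `caCarried_of_inputs` — Ga for general `T` (the body of `caCarried_tower_of_inputs` over the general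
  `caCarried_of_pieces`, `exists_mem_cohomologyAnnihilator_iff_forall_stableAnnIdeals`, `stableAnnModule_spec`);
* `carriedPrincipal_of_carried` — Gb for general `T` (the body of `carriedPrincipal_tower_of_carried` over
  the general `carriedPrincipal_of_divisor_of_pred`, with `hrat` a hypothesis);
* `caInvertible_of_hasTrivialCechH1` — (A-rat), strong form: ANY resolution `π` with `Ȟ¹ = 0`, EVERY `x ∈ X`,
  `ca(T)·𝒪_{X,x}` principal; no minimality / `¬ IsRegularLocalRing` / `IsLocalHom` binders (all idle in p513073's proof);
* `caInvertibleMinRes_of_hasRationalSingularity` — (A-rat) in the planner's CUT shape (res-L0-w44-plan-1 g12,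
  08:48:36Z: `(h121ii) (hGW) (hdim2) (hsing) (hca) (hπ) (hrat) (x) (hx)`), one line from the strong form;
* `exists_maximalIdeal_pow_le_cohomologyAnnihilator_of_isIntegrallyClosed` — the hypothesis `hca` DISCHARGED
  for `T` essentially of finite type over a field, by citation of Literature/RingTheory/CohomologyAnnihilator/
  Completion.lean (Iyengar–Takahashi Thm 5.4 `…_of_essFiniteType` + `R₁` isolated-singularity lemma), and
  `caInvertible_of_hasTrivialCechH1_of_essFiniteType` — the form the K44S-DESCENT germs (local rings of
  closed points on blow-ups of varieties over `k`) consume.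

References: Lipman, Publ. IHÉS 36 (1969), Thm. (12.1) (ii) [`Lipman1969`]; Iyama–Wemyss, Math. Z. 265 (2010), Thm 2.7
[`IyamaWemyss2010`]; Iyengar–Takahashi, IMRN 2016 [`IyengarTakahashi2014`]; Görtz–Wedhorn II (2023), Cor. 24.44 [`GortzWedhorn2023`]. -/

noncomputable section
set_option linter.dupNamespace false

namespace Summit.ResolutionOfSingularities.ResolutionOfSingularities.Theorems.NoZeno.SandwichCluster

open CategoryTheory CategoryTheory.Abelian AlgebraicGeometry TopologicalSpace IsLocalRing Order
open Literature.RingTheory.CohomologyAnnihilator (cohomologyAnnihilator)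
open Literature.AlgebraicGeometry.Morphisms Literature.AlgebraicGeometry.Modules
open Literature.AlgebraicGeometry.Resolution Literature.AlgebraicGeometry.Motives
open Summit.ResolutionOfSingularities.ResolutionOfSingularities.Theorems.NoZeno.Birth

section General

variable {T : Type} [CommRing T] [IsDomain T] [IsNoetherianRing T] [IsIntegrallyClosed T] [IsLocalRing T]
  {X : Scheme.{0}} [IsIntegral X] [IsLocallyNoetherian X] (π : X ⟶ Spec (.of T))

/-- **Ga for an arbitrary two-dimensional Noetherian local normal domain `T`.**  For ANY resolution
`π : X ⟶ Spec T` (minimality is not used): if (hG2) every finitely generated reflexive `T`-module `M` with `Ext¹(M, T) = 0` has an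
affine-localizing sheaf `F` with `End̲(M) ≃ Ȟ¹(𝒰, F)` on every finite affine cover, (hL) LEMMA L holds on
`X` for affine-localizing sheaves on every finite affine cover, (hdict) the two indexings of the exceptional
curves agree, and `𝔪^c ⊆ ca(T) ∋ y ≠ 0`, then `ca(T)` is `X`-carried: ONE cycle `Z` with
`t ∈ ca(T) ↔ (t = 0 ∨ ∀ η ∈ excCurvePoints π, Z η ≤ ord_η t)`.  (Body of `caCarried_tower_of_inputs`.)
[this work] -/
theorem caCarried_of_inputs (hπ : IsResolution π) (hdim2 : ringKrullDim T = 2)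
    (hG2 : ∀ (M : Type) [AddCommGroup M] [Module T M] [Module.Finite T M],
      Module.IsReflexive T M →
      (∀ e : Ext (ModuleCat.of T M) (ModuleCat.of T T) 1, e = 0) →
      ∃ F : X.Modules, IsAffineLocalizing F ∧
        ∀ (ι : Type) [Finite ι] (U : ι → X.Opens), (∀ i, IsAffineOpen (U i)) → ⨆ i, U i = ⊤ →
          Nonempty (StableEnd T M ≃ₗ[T] CechMH1 π F U))
    (hL : ∀ (F : X.Modules), IsAffineLocalizing F →
      ∀ (ι : Type) [Finite ι] (U : ι → X.Opens), (∀ i, IsAffineOpen (U i)) → ⨆ i, U i = ⊤ →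
      ∀ c : ℕ, maximalIdeal T ^ c ≤ Module.annihilator T (CechMH1 π F U) →
      ∀ t : T, (∀ η ∈ excPoints π, ∃ a ∈ Module.annihilator T (CechMH1 π F U),
        a ≠ 0 ∧ Scheme.ord (baseToFunctionField π a) η ≤ Scheme.ord (baseToFunctionField π t) η) →
        t ∈ Module.annihilator T (CechMH1 π F U))
    (hdict : excCurvePoints π = excPoints π)
    (c : ℕ) (hc : maximalIdeal T ^ c ≤ cohomologyAnnihilator T)
    (y : T) (hy0 : y ≠ 0) (hy : y ∈ cohomologyAnnihilator T) :
    ∃ Z : X → ℕ, ∀ t : T, t ∈ cohomologyAnnihilator T ↔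
      (t = 0 ∨ ∀ η ∈ excCurvePoints π, (Z η : ℤ) ≤ Scheme.ord (baseToFunctionField π t) η) := by
  classical
  -- a finite affine open cover of the (quasi-compact) resolution
  haveI : IsProper π := hπ.isProper
  haveI : CompactSpace X := QuasiCompact.compactSpace_of_compactSpace π
  obtain ⟨S, hS, hcov⟩ := (isCompact_iff_finite_and_eq_biUnion_affineOpens (U := (⊤ : X.Opens))).mp
    (CompactSpace.isCompact_univ (X := X))
  haveI : Finite S := hS.to_subtype
  let U : S → X.Opens := fun i => (i.1 : X.Opens)
  have hUaff : ∀ i, IsAffineOpen (U i) := fun i => i.1.2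
  have hUcov : ⨆ i, U i = ⊤ := by
    change ⨆ i : S, ((i.1 : X.affineOpens) : X.Opens) = ⊤
    rw [iSup_subtype'', ← hcov]
  -- the CA-layer family
  obtain ⟨N, hN4, -, hca⟩ := exists_mem_cohomologyAnnihilator_iff_forall_stableAnnIdeals (T := T)
  -- G2 for each member of the family
  have hG2' : ∀ j : stableAnnIdeals T N, ∃ F : X.Modules, IsAffineLocalizing F ∧
      Nonempty (StableEnd T (stableAnnModule j) ≃ₗ[T] CechMH1 π F U) := fun j => by
    obtain ⟨hfin, hrefl, hW⟩ := stableAnnModule_spec (T := T) hdim2 hN4 j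
    haveI := hfin
    obtain ⟨F, hFaff, hF⟩ := hG2 (stableAnnModule j) hrefl hW
    exact ⟨F, hFaff, hF S U hUaff hUcov⟩
  -- the glue
  obtain ⟨Z, hZ⟩ := caCarried_of_pieces π U
    (fun t _ η _ => ord_baseToFunctionField_nonneg π t η)
    (N := fun j : stableAnnIdeals T N => stableAnnModule j) hca hG2'
    (fun F hF c' hc' t ht => hL F hF S U hUaff hUcov c' hc' t ht) c hc y hy0 hy
  refine ⟨Z, fun t => ?_⟩
  rw [hZ t, hdict]

/-- **Gb for an arbitrary two-dimensional Noetherian local normal domain `T` with a RATIONAL singularity**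
(Lipman (12.1) (ii); `hrat` a hypothesis): for ANY resolution `π : X ⟶ Spec T` with `H¹ = 0`, a cycle `Z` and an
ideal `I` of `T` carried by `Z` along the integral exceptional curves, `I · 𝒪_{X,x}` is principal at every
point `x` (no regularity hypothesis on `T`).  (Body of `carriedPrincipal_tower_of_carried`.) [cite: Lipman1969, Theorem (12.1) (ii) (p. 220)] -/
theorem carriedPrincipal_of_carried (h121ii : Lipman1969_12_1_ii.{0}) (hdim2 : ringKrullDim T = 2)
    (hπ : IsResolution π) (hrat : HasTrivialCechH1 π)
    (Z : X → ℕ) (I : Ideal T)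
    (hI : ∀ t : T, t ∈ I ↔
      (t = 0 ∨ ∀ η ∈ excCurvePoints π, (Z η : ℤ) ≤ Scheme.ord (baseToFunctionField π t) η))
    (x : X) :
    (Ideal.map (((X.presheaf.germ ⊤ x trivial).hom.comp
      (π.appTop.hom.comp (Scheme.ΓSpecIso (CommRingCat.of T)).inv.hom)) : T →+* X.presheaf.stalk x)
        I).IsPrincipal := by
  classical
  have hπres : IsResolution π := hπ
  haveI : IsProper π := hπres.isProper
  have hX : Scheme.IsRegular X := hπres.isRegular
  -- `H⁰(X, 𝒪_X) = T`
  have hH0 : ∀ s : X.functionField, (∀ y : X, RatFn.IsRegularAt y s) →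
      ∃ t : T, baseToFunctionField π t = s :=
    fun s hs => hπres.exists_baseToFunctionField_eq_of_forall_isRegularAt π s hs
  -- injectivity of the structure map `T → K(X)`
  have hinj : Function.Injective (baseToFunctionField π) := LemmaL.baseToFunctionField_injective π hπres
  -- the finite set `F` of integral exceptional curves, all of codimension one
  have hFfin : (excCurvePoints π).Finite :=
    (excPoints_finite π).subset (hπres.excCurvePoints_subset_excPoints hdim2)
  set F : Finset X := hFfin.toFinset with hFdef
  have hFmem : ∀ η, η ∈ F ↔ η ∈ excCurvePoints π := fun η => Set.Finite.mem_toFinset hFfin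
  have hcoh : ∀ η ∈ F, coheight η = 1 := fun η hη =>
    hπres.coheight_eq_one_of_mem_excCurvePoints hdim2 ((hFmem η).mp hη)
  -- orders of elements of `T` along the curves are non-negative
  have hord_nonneg : ∀ (t : T) (η : X), 0 ≤ Scheme.ord (baseToFunctionField π t) η :=
    fun t η => (isRegularAt_baseToFunctionField π η t).ord_nonneg
  -- a nonzero element of `I`: `y ^ N`, `y ∈ 𝔪_T ∖ 0`, `N = max Z`
  have hnf : ¬ IsField T := fun hf => by
    have h0 := ringKrullDim_eq_zero_of_isField hf
    rw [hdim2] at h0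
    exact absurd h0 (by decide)
  obtain ⟨y, hy𝔪, hy0⟩ : ∃ y ∈ maximalIdeal T, y ≠ 0 := by
    by_contra! h
    exact hnf (isField_iff_maximalIdeal_eq.mpr (le_bot_iff.mp fun z hz => h z hz))
  have hy1 : ∀ η ∈ F, 1 ≤ Scheme.ord (baseToFunctionField π y) η := by
    intro η hη
    have hreg := isRegularAt_baseToFunctionField π η y
    have hne : baseToFunctionField π y ≠ 0 := fun h => hy0 (hinj (by rw [h, map_zero]))
    have hnu : ¬ RatFn.IsUnitAt η (baseToFunctionField π y) := by
      rintro ⟨u, hu⟩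
      rw [← toFunctionField_germ_appTop π η y] at hu
      have := RatFn.toFunctionField_injective η hu
      exact not_isUnit_germ_appTop_of_mem_maximalIdeal π ((hFmem η).mp hη).1 hy𝔪 (this ▸ u.isUnit)
    have := hreg.ord_pos hnu hne (hcoh η hη)
    omega
  set N : ℕ := F.sup Z with hN
  have hyN : y ^ N ∈ I := by
    refine (hI _).mpr (Or.inr fun η hη => ?_)
    have hηF : η ∈ F := (hFmem η).mpr hη
    rw [map_pow, RatFn.ord_pow (fun h => hy0 (hinj (by rw [h, map_zero]))) η N]
    calc (Z η : ℤ) ≤ N := by exact_mod_cast Finset.le_sup (f := Z) hηF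
      _ = N * 1 := (mul_one _).symm
      _ ≤ N * Scheme.ord (baseToFunctionField π y) η :=
          mul_le_mul_of_nonneg_left (hy1 η hηF) (Nat.cast_nonneg N)
  have hyN0 : y ^ N ≠ 0 := pow_ne_zero N hy0
  -- the gcd cycle `Z'` of `I` on `F`
  let V : X → Set ℕ := fun η =>
    {n | ∃ t ∈ I, t ≠ 0 ∧ (Scheme.ord (baseToFunctionField π t) η).toNat = n}
  have hVne : ∀ η, (V η).Nonempty := fun η => ⟨_, y ^ N, hyN, hyN0, rfl⟩
  let Z' : X → ℕ := fun η => sInf (V η)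
  have hZ'le : ∀ t ∈ I, t ≠ 0 → ∀ η, (Z' η : ℤ) ≤ Scheme.ord (baseToFunctionField π t) η := by
    intro t ht ht0 η
    have h1 : Z' η ≤ (Scheme.ord (baseToFunctionField π t) η).toNat := Nat.sInf_le ⟨t, ht, ht0, rfl⟩
    have h2 := Int.toNat_of_nonneg (hord_nonneg t η)
    omega
  have hZ'att : ∀ η, ∃ t ∈ I, t ≠ 0 ∧ Scheme.ord (baseToFunctionField π t) η = Z' η := by
    intro η
    obtain ⟨t, ht, ht0, hteq⟩ := Nat.sInf_mem (hVne η)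
    refine ⟨t, ht, ht0, ?_⟩
    have h2 := Int.toNat_of_nonneg (hord_nonneg t η)
    change (Scheme.ord (baseToFunctionField π t) η).toNat = Z' η at hteq
    omega
  have hZZ' : ∀ η ∈ F, Z η ≤ Z' η := by
    intro η hη
    obtain ⟨t, ht, ht0, hteq⟩ := hZ'att η
    rcases (hI t).mp ht with h0 | h
    · exact absurd h0 ht0
    · have := h η ((hFmem η).mp hη)
      rw [hteq] at this
      exact_mod_cast this
  -- `I` is carried by `Z'` (on `F`)
  have hI' : ∀ t : T, t ∈ I ↔
      (t = 0 ∨ ∀ η ∈ F, (Z' η : ℤ) ≤ Scheme.ord (baseToFunctionField π t) η) := by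
    intro t
    constructor
    · intro ht
      by_cases ht0 : t = 0
      · exact Or.inl ht0
      · exact Or.inr fun η _ => hZ'le t ht ht0 η
    · rintro (rfl | h)
      · exact Submodule.zero_mem I
      · refine (hI t).mpr (Or.inr fun η hη => ?_)
        have hηF : η ∈ F := (hFmem η).mpr hη
        exact (Int.ofNat_le.mpr (hZZ' η hηF)).trans (h η hηF)
  -- the divisor `D = -D_{Z'}` and its section characterisation
  set D := -(CartierDivisor.ofIsEffectiveCartier (∏ η ∈ F, primeDivisorIdeal η ^ Z' η)
    (isEffectiveCartier_cycleIdeal hX F Z' hcoh)) with hDdef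
  have hDsec : ∀ s : X.functionField, D.IsSection s ↔ ((∀ x : X, RatFn.IsRegularAt x s) ∧
      (s = 0 ∨ ∀ η ∈ F, (Z' η : ℤ) ≤ Scheme.ord s η)) :=
    neg_cycleDivisor_isSection_iff hX F Z' hcoh
  -- non-negative degrees on the integral exceptional curves (gcd trick)
  have hDdeg : ∀ η ∈ excCurvePoints π, 0 ≤ excCurveDegree π D η := by
    intro η hη
    have hηF : η ∈ F := (hFmem η).mpr hη
    obtain ⟨t, ht, ht0, hteq⟩ := hZ'att η
    set s := baseToFunctionField π t with hsdef
    have hs0 : s ≠ 0 := fun h => ht0 (hinj (by rw [← hsdef, h, map_zero]))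
    have hsec : D.IsSection s := (hDsec s).mpr
      ⟨fun y => isRegularAt_baseToFunctionField π y t, Or.inr fun η' _ => hZ'le t ht ht0 η'⟩
    have heff : (D + CartierDivisor.principal s hs0).IsEffective :=
      (isEffective_neg_add_principal_iff _ hs0).mpr hsec
    have hav : (D + CartierDivisor.principal s hs0).Avoids η :=
      (CartierDivisor.avoids_add_principal_iff _ hs0).mpr
        (mem_nonvanishing_neg_cycleDivisor_of_ord_eq hX F Z' hcoh hs0 hsec hηF hteq)
    have h := excCurveDegree_nonneg_of_isEffective π hη heff hav
    rwa [excCurveDegree_add π hη, excCurveDegree_principal π hη hs0, add_zero] at h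
  -- assembly
  exact carriedPrincipal_of_divisor_of_pred h121ii hdim2.le π hπres hrat
    (fun s => ∀ η ∈ F, (Z' η : ℤ) ≤ Scheme.ord s η) I hI' D hDsec hDdeg hH0 x

/-- **(A-rat), strong form: THEOREM A for an arbitrary rational surface singularity with `𝔪`-primary
cohomology annihilator, at EVERY point and with no regularity hypothesis.**  Let `T` be a two-dimensional
Noetherian local normal domain whose cohomology annihilator contains a power of the maximal ideal (automatic,
with `ca = T`, when `T` is regular — that case is trivial), and `π : X ⟶ Spec T` ANY resolution (minimality is
never used) with `H¹(X, 𝒪_X) = 0` (trivial Čech `H¹` on finite affine covers).  Then, conditionally on Lipman 1969 (12.1) (ii)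
and Görtz–Wedhorn II Cor. 24.44, the extension of `ca(T)` along the structure map `T → 𝒪_{X,x}` is a
principal ideal for EVERY point `x` of `X` (p513073's closed-fibre restriction `IsLocalHom …` is not needed by
the proof).  Same proof term as the chain's `stub_caInvertibleMinRes` (p513073) with the stage package, the
derived rationality and the derived `𝔪`-primarity replaced by the hypotheses `hdim2`/instances, `hrat`, `hca`;
no `¬ IsRegularLocalRing T` binder (the regular case is discharged by `ca(T) = T`).  The planner's cut
(binders `hsing`, `hx` included) is `caInvertibleMinRes_of_hasRationalSingularity` below.
[cite: Lipman1969, Theorem (12.1) (ii) (p. 220); IyamaWemyss2010, Thm 2.7] -/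
theorem caInvertible_of_hasTrivialCechH1
    (h121ii : Lipman1969_12_1_ii.{0}) (hGW : GortzWedhorn2023_24_44_H2.{0})
    (hdim2 : ringKrullDim T = 2) (hca : ∃ c : ℕ, maximalIdeal T ^ c ≤ cohomologyAnnihilator T)
    (hπ : IsResolution π) (hrat : HasTrivialCechH1 π) (x : X) :
    (Ideal.map (((X.presheaf.germ ⊤ x trivial).hom.comp
      (π.appTop.hom.comp (Scheme.ΓSpecIso (CommRingCat.of T)).inv.hom)) : T →+* X.presheaf.stalk x)
      (cohomologyAnnihilator T)).IsPrincipal := by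
  classical
  -- a REGULAR `T` has `ca(T) = T` (Iyengar–Takahashi Example 2.5, tree), whose extension is the unit ideal
  by_cases hsing : IsRegularLocalRing T
  · rw [Literature.RingTheory.CohomologyAnnihilator.cohomologyAnnihilator_eq_top_of_isRegularLocalRing T,
      Ideal.map_top]
    exact top_isPrincipal
  haveI : IsProper π := hπ.isProper
  -- `ca` is `𝔪`-primary with a non-zero element
  obtain ⟨c, hc⟩ := hca
  have hm : maximalIdeal T ≠ ⊥ := fun h =>
    hsing (isRegularLocalRing_of_isField (IsLocalRing.isField_iff_maximalIdeal_eq.mpr h))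
  obtain ⟨y, hy, hy0⟩ := (maximalIdeal T ^ c).ne_bot_iff.mp (pow_ne_zero c hm)
  have hyca : y ∈ cohomologyAnnihilator T := hc hy
  -- (S1) G2-MAIN, consumed form (p512050 `_of_inputs` + (iv) p510783 + (vii) p510810)
  have hG2 : ∀ (M : Type) [AddCommGroup M] [Module T M] [Module.Finite T M],
      Module.IsReflexive T M →
      (∀ e : Ext (ModuleCat.of T M) (ModuleCat.of T T) 1, e = 0) →
      ∃ F : X.Modules, IsAffineLocalizing F ∧
        ∀ (ι : Type) [Finite ι] (U : ι → X.Opens), (∀ i, IsAffineOpen (U i)) → ⨆ i, U i = ⊤ →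
          Nonempty (StableEnd T M ≃ₗ[T] CechMH1 π F U) := by
    intro M _ _ _ hM hW
    obtain ⟨F, -, haff, -, hcov⟩ :=
      FullSheaf.exists_locallyFree_stableEnd_equiv_cechMH1_of_inputs π M hπ hM
        (fun r φ hφ hφinj =>
          FullSheaf.fullSheaf_isFiniteLocallyFree T X π M φ hdim2 hπ hrat hGW hM hφ hφinj)
        (fun r φ hφ hφinj ι _ U hU hcov =>
          FullSheaf.fullSheaf_dual_cechMH1_subsingleton T X π M φ hπ hrat hW hφ hφinj U hU hcov)
    exact ⟨F, haff, hcov⟩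
  -- (S2) LEMMA L (p507314), side conditions discharged from the tree
  have hL : ∀ (F : X.Modules), IsAffineLocalizing F →
      ∀ (ι : Type) [Finite ι] (U : ι → X.Opens), (∀ i, IsAffineOpen (U i)) → ⨆ i, U i = ⊤ →
      ∀ c : ℕ, maximalIdeal T ^ c ≤ Module.annihilator T (CechMH1 π F U) →
      ∀ t : T, (∀ η ∈ excPoints π, ∃ a ∈ Module.annihilator T (CechMH1 π F U),
        a ≠ 0 ∧ Scheme.ord (baseToFunctionField π a) η ≤ Scheme.ord (baseToFunctionField π t) η) →
        t ∈ Module.annihilator T (CechMH1 π F U) :=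
    LemmaL.lemmaL_of_GW π hGW hπ hdim2 hsing
  -- (S3) dictionary: both indexings of the exceptional curves agree on `X_min`
  have hdict : excCurvePoints π = excPoints π :=
    (IsResolution.excPoints_eq_excCurvePoints (π := π) hdim2 hπ hsing).symm
  -- Ga: `ca(T)` is carried
  obtain ⟨Z, hZ⟩ := caCarried_of_inputs π hπ hdim2 hG2 hL hdict c hc y hy0 hyca
  -- Gb: carried ideals of a rational singularity are principal at every stalk
  exact carriedPrincipal_of_carried π h121ii hdim2 hπ hrat Z _ hZ x

/-- **(A-rat) `caInvertibleMinRes_of_hasRationalSingularity` — the W4.4 planner's CUT verbatim** (CHAIN v11.1 §2,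
res-L0-w44-plan-1 g12 2026-08-27T08:48:36Z: binders `(h121ii) (hGW) (hdim2) (hsing) (hca) (hπ) (hrat) (x) (hx)`,
«TWO facts + hca + hrat, nothing else»): for `T` a two-dimensional Noetherian local normal domain, not regular,
with `𝔪^c ⊆ ca(T)`, `π : X ⟶ Spec T` a minimal resolution with `H¹(X, 𝒪_X) = 0` and `x` a point of the closed
fibre (structure map `T → 𝒪_{X,x}` local), `ca(T)·𝒪_{X,x}` is principal.  OURS; generalises THEOREM A
`stub_caInvertibleMinRes` (p513073) off the canonical tower; NOT a statement of the manuscript under review.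
One line from the strong form `caInvertible_of_hasTrivialCechH1` (any resolution; `hsing`, `hx` not needed there).
[cite: Lipman1969, Theorem (12.1) (ii) (p. 220); IyamaWemyss2010, Thm 2.7] -/
theorem caInvertibleMinRes_of_hasRationalSingularity
    (h121ii : Lipman1969_12_1_ii.{0}) (hGW : GortzWedhorn2023_24_44_H2.{0})
    (hdim2 : ringKrullDim T = 2) (_hsing : ¬ IsRegularLocalRing T)
    (hca : ∃ c : ℕ, maximalIdeal T ^ c ≤ cohomologyAnnihilator T)
    (hπ : IsMinimalResolution π) (hrat : HasTrivialCechH1 π) (x : X)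
    (_hx : IsLocalHom (((X.presheaf.germ ⊤ x trivial).hom.comp
      (π.appTop.hom.comp (Scheme.ΓSpecIso (CommRingCat.of T)).inv.hom)) : T →+* X.presheaf.stalk x)) :
    (Ideal.map (((X.presheaf.germ ⊤ x trivial).hom.comp
      (π.appTop.hom.comp (Scheme.ΓSpecIso (CommRingCat.of T)).inv.hom)) : T →+* X.presheaf.stalk x)
      (cohomologyAnnihilator T)).IsPrincipal :=
  caInvertible_of_hasTrivialCechH1 π h121ii hGW hdim2 hca hπ.1 hrat x

end General

/-! ## §2 The `𝔪`-primarity hypothesis discharged for germs essentially of finite type over a field -/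

section EssFiniteType

variable {T : Type} [CommRing T] [IsDomain T] [IsNoetherianRing T] [IsIntegrallyClosed T] [IsLocalRing T]
  {X : Scheme.{0}} [IsIntegral X] [IsLocallyNoetherian X] (π : X ⟶ Spec (.of T))

/-- **`ca(T)` is `𝔪`-primary (or the unit ideal) for a normal local domain of dimension `≤ 2` essentially of
finite type over a field** — in the `Algebra.EssFiniteType k T` packaging, by CITATION of two PROVED theorems of
`Literature/RingTheory/CohomologyAnnihilator/Completion.lean`: the normal `T` of dimension `≤ 2` is an isolated
singularity (`isIsolatedSingularity_of_isIntegrallyClosed_of_ringKrullDim_le_two`, `R₁`), and for a local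
isolated singularity which is a localisation of a finitely generated `k`-algebra `ca ⊇ 𝔪^N` (Iyengar–Takahashi
Thm 5.4 via `singEqVCa_essFiniteType_holds`: Literature's `exists_maximalIdeal_pow_le_cohomologyAnnihilator_of_essFiniteType`);
`T` is the localisation of `Algebra.EssFiniteType.subalgebra k T` at `Algebra.EssFiniteType.submonoid k T`
(Mathlib), a finitely generated domain of finite Krull dimension (`exists_ringKrullDim_eq_and_trdeg_eq`).
(res-L0-w44-stub-5's tower-only `exists_maximalIdeal_pow_le_cohomologyAnnihilator_tower`, now for any such `T`.)
[cite: IyengarTakahashi2014, Thm. 5.4; Matsumura1987, Theorem 11.2 (4)⇒(1) (consequence)] -/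
theorem exists_maximalIdeal_pow_le_cohomologyAnnihilator_of_isIntegrallyClosed (k : Type) [Field k]
    [Algebra k T] [Algebra.EssFiniteType k T] (hdim : ringKrullDim T ≤ 2) :
    ∃ c : ℕ, maximalIdeal T ^ c ≤ cohomologyAnnihilator T := by
  obtain ⟨d, hd, -⟩ := exists_ringKrullDim_eq_and_trdeg_eq k ↥(Algebra.EssFiniteType.subalgebra k T)
  exact Literature.RingTheory.CohomologyAnnihilator.exists_maximalIdeal_pow_le_cohomologyAnnihilator_of_essFiniteType
    (k := k) (A := ↥(Algebra.EssFiniteType.subalgebra k T)) inferInstance hd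
    (Algebra.EssFiniteType.submonoid k T) inferInstance
    (Literature.RingTheory.CohomologyAnnihilator.isIsolatedSingularity_of_isIntegrallyClosed_of_ringKrullDim_le_two
      hdim)

/-- **(A-rat) for germs essentially of finite type over a field** — the hypothesis `hca` of
`caInvertible_of_hasTrivialCechH1` / `caInvertibleMinRes_of_hasRationalSingularity` discharged: for `T` a two-dimensional normal local domain
essentially of finite type over a field `k`, `π : X ⟶ Spec T` ANY resolution with `H¹(X, 𝒪_X) = 0`, and ANY
`x ∈ X`, `ca(T)·𝒪_{X,x}` is principal — conditionally on Lipman (12.1) (ii) and Görtz–Wedhorn II 24.44 only;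
this is the planner's REFACTOR TARGET A-rat of K44S-DESCENT v1 §2 (a) (`heft` = the `Algebra.EssFiniteType k T`
instance) with its vacuous `IsLocalHom` premise dropped (stronger). [cite: Lipman1969, Theorem (12.1) (ii) (p. 220); IyengarTakahashi2014, Thm. 5.4] -/
theorem caInvertible_of_hasTrivialCechH1_of_essFiniteType
    (h121ii : Lipman1969_12_1_ii.{0}) (hGW : GortzWedhorn2023_24_44_H2.{0})
    (k : Type) [Field k] [Algebra k T] [Algebra.EssFiniteType k T]
    (hdim2 : ringKrullDim T = 2) (hπ : IsResolution π) (hrat : HasTrivialCechH1 π) (x : X) :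
    (Ideal.map (((X.presheaf.germ ⊤ x trivial).hom.comp
      (π.appTop.hom.comp (Scheme.ΓSpecIso (CommRingCat.of T)).inv.hom)) : T →+* X.presheaf.stalk x)
      (cohomologyAnnihilator T)).IsPrincipal :=
  caInvertible_of_hasTrivialCechH1 π h121ii hGW hdim2
    (exists_maximalIdeal_pow_le_cohomologyAnnihilator_of_isIntegrallyClosed k hdim2.le) hπ hrat x

end EssFiniteType

end Summit.ResolutionOfSingularities.ResolutionOfSingularities.Theorems.NoZeno.SandwichCluster

end
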